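import Literature.Probability.Percolation.CutBlocks
import Literature.Probability.Percolation.GluingChainStructure
import Literature.Probability.Percolation.ZonesOwners
import HarnessLib

/-!
# The tube of a connected cut is connected

Topic `Probability/Percolation`.  Support file (proofs, no named fact) for the named fact
`SchrammSmirnov2011_thm_1_7` (zone geometry of the proof of Prop. 4.1, Ann. Probab. 39 (2011), §4):
the hypothesis `Zones.Nice.N_conn` for the zones `CutBlocks.zones` of a CONNECTED cut `α`
(`zones_N_conn`).  The open `s/2`-neighbourhood of `α` is preconnected
(`isPreconnected_thickening`); the tube blocks cover it, so any two of them are joined by a chain of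
tube blocks consecutive ones of which share a point of the neighbourhood
(`exists_reflTransGen_of_isPreconnected_inter`), hence — inserting the block spanned by the
abscissa of one and the ordinate of the other, which contains the shared point — by a chain of
tube blocks changing one coordinate at a time (`tubeBlocks_chain`); inside a block the mesh sites
form a discrete rectangle, and horizontally or vertically adjacent blocks carry adjacent sites
(`exists_adj_sites_right/up`), for meshes `δ ≤ s`.

## References

* O. Schramm, S. Smirnov, *On the scaling limits of planar percolation*, Ann. Probab. 39 (2011)
  1768–1814, arXiv:1101.5820, §4, proof of Prop. 4.1. [SchrammSmirnov2011]
-/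

noncomputable section

open Set Metric Relation
open Literature.Probability.LatticeModels

namespace Literature.Probability.Percolation

namespace CutBlocks

variable {s : ℝ} {α : Set ℂ} {δ : ℝ}

/-! ### The neighbourhood of a connected set is connected -/

/-- **The open thickening of a preconnected set is preconnected.** [folklore] -/
theorem isPreconnected_thickening {A : Set ℂ} (hA : IsPreconnected A) (t : ℝ) : IsPreconnected (thickening t A) := by
  rcases le_or_gt t 0 with ht | ht
  · rw [thickening_of_nonpos ht]; exact isPreconnected_empty
  refine isPreconnected_of_forall_pair fun x hx y hy => ?_
  obtain ⟨a, ha, hxa⟩ := mem_thickening_iff.1 hx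
  obtain ⟨b, hb, hyb⟩ := mem_thickening_iff.1 hy
  refine ⟨ball a t ∪ A ∪ ball b t, ?_, Or.inl (Or.inl (mem_ball.2 hxa)), Or.inr (mem_ball.2 hyb), ?_⟩
  · refine union_subset (union_subset (ball_subset_thickening ha t) (self_subset_thickening ht A)) (ball_subset_thickening hb t)
  · refine IsPreconnected.union b ?_ (mem_ball_self ht) (IsPreconnected.union a (mem_ball_self ht) ha
      (convex_ball a t).isPreconnected hA) (convex_ball b t).isPreconnected
    exact Or.inr hb

/-! ### Blocks sharing a point -/

/-- A point of two blocks lies in the block spanned by the abscissa of the first and the ordinate of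
the second. [folklore] -/
theorem mem_block_mixed {w : ℂ} {z z' : ℤ × ℤ} (hz : w ∈ block s z) (hz' : w ∈ block s z') :
    w ∈ block s (z.1, z'.2) :=
  ⟨hz.1, hz.2.1, hz'.2.2.1, hz'.2.2.2⟩

/-- Two blocks sharing a point are at sup-distance at most one. [folklore] -/
theorem near_of_mem_block (hs : 0 < s) {w : ℂ} {z z' : ℤ × ℤ} (hz : w ∈ block s z) (hz' : w ∈ block s z') :
    |z.1 - z'.1| ≤ 1 ∧ |z.2 - z'.2| ≤ 1 := by
  obtain ⟨h1, h2, h3, h4⟩ := hz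
  obtain ⟨h1', h2', h3', h4'⟩ := hz'
  have e1 : (z.1 : ℝ) < z'.1 + 2 := by nlinarith
  have e2 : (z'.1 : ℝ) < z.1 + 2 := by nlinarith
  have e3 : (z.2 : ℝ) < z'.2 + 2 := by nlinarith
  have e4 : (z'.2 : ℝ) < z.2 + 2 := by nlinarith
  have f1 : z.1 < z'.1 + 2 := by exact_mod_cast e1
  have f2 : z'.1 < z.1 + 2 := by exact_mod_cast e2
  have f3 : z.2 < z'.2 + 2 := by exact_mod_cast e3
  have f4 : z'.2 < z.2 + 2 := by exact_mod_cast e4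
  constructor <;> rw [abs_le] <;> constructor <;> omega

/-! ### The chain of tube blocks -/

/-- One coordinate at a time: blocks equal or adjacent horizontally or vertically. [folklore] -/
def OneStep (a b : ℤ × ℤ) : Prop := (a.1 = b.1 ∧ |a.2 - b.2| ≤ 1) ∨ (a.2 = b.2 ∧ |a.1 - b.1| ≤ 1)

/-- **Any two tube blocks of a connected cut are joined by a chain of tube blocks changing one
coordinate at a time.** [folklore] -/
theorem tubeBlocks_chain (hs : 0 < s) (hα : Bornology.IsBounded α) (hαc : IsPreconnected α) {z₁ z₂ : ℤ × ℤ}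
    (h₁ : z₁ ∈ tubeBlocks s α) (h₂ : z₂ ∈ tubeBlocks s α) :
    ReflTransGen (fun a b => a ∈ tubeBlocks s α ∧ b ∈ tubeBlocks s α ∧ OneStep a b) z₁ z₂ := by
  classical
  set C := thickening (s / 2) α with hC
  -- the cover of the neighbourhood by the tube blocks
  set P : ℤ × ℤ → Set ℂ := fun z => if z ∈ tubeBlocks s α then block s z else ∅ with hP
  have hPcl : ∀ z, IsClosed (P z) := by
    intro z
    simp only [hP]
    split_ifs
    · -- a block is closed: an intersection of closed half-planes
      have : block s z = (Complex.re ⁻¹' Icc (s * z.1) (s * (z.1 + 1))) ∩ (Complex.im ⁻¹' Icc (s * z.2) (s * (z.2 + 1))) := by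
        ext w; simp [block, and_assoc]
      rw [this]
      exact (isClosed_Icc.preimage Complex.continuous_re).inter (isClosed_Icc.preimage Complex.continuous_im)
    · exact isClosed_empty
  have hPfin : {z | (P z).Nonempty}.Finite := by
    refine (tubeBlocks_finite hs hα).subset fun z hz => ?_
    by_contra h
    simp [hP, h] at hz
  have hCsub : C ⊆ ⋃ z, P z := by
    intro w hw
    have hz : blockOf s w ∈ tubeBlocks s α := ⟨w, mem_block_blockOf hs w, hw⟩
    exact mem_iUnion.2 ⟨blockOf s w, by simp only [hP, if_pos hz]; exact mem_block_blockOf hs w⟩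
  have hPmem : ∀ {z w}, w ∈ P z → z ∈ tubeBlocks s α ∧ w ∈ block s z := by
    intro z w hw
    by_cases hz : z ∈ tubeBlocks s α
    · simp only [hP, if_pos hz] at hw; exact ⟨hz, hw⟩
    · simp [hP, hz] at hw
  have hne : ∀ {z}, z ∈ tubeBlocks s α → (C ∩ P z).Nonempty := by
    intro z hz
    obtain ⟨w, hwb, hwC⟩ := hz
    exact ⟨w, hwC, by simp only [hP, if_pos (show z ∈ tubeBlocks s α from ⟨w, hwb, hwC⟩)]; exact hwb⟩
  have hchain := QuadCrossing.exists_reflTransGen_of_isPreconnected_inter P hPcl hPfin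
    (isPreconnected_thickening hαc _) hCsub (hne h₁) (hne h₂)
  -- refine each link through the mixed block
  clear h₁ h₂
  induction hchain with
  | refl => exact ReflTransGen.refl
  | @tail a b _ hab ih =>
    obtain ⟨w, ⟨hwC, hwa⟩, hwb⟩ := hab
    obtain ⟨ha, hwa'⟩ := hPmem hwa
    obtain ⟨hb, hwb'⟩ := hPmem hwb
    have hm : (a.1, b.2) ∈ tubeBlocks s α := ⟨w, mem_block_mixed hwa' hwb', hwC⟩
    obtain ⟨d1, d2⟩ := near_of_mem_block hs hwa' hwb'
    have s1 : OneStep a (a.1, b.2) := Or.inl ⟨rfl, d2⟩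
    have s2 : OneStep (a.1, b.2) b := Or.inr ⟨rfl, d1⟩
    exact (ih.tail ⟨ha, hm, s1⟩).tail ⟨hm, hb, s2⟩

/-! ### Sites of a block -/

/-- The mesh sites of a block. [folklore] -/
def blockSites (s : ℝ) (z : ℤ × ℤ) (δ : ℝ) : Set (Site 2) := {v | meshPoint δ v ∈ block s z}

/-- Membership in the sites of a block, in coordinates. [folklore] -/
theorem mem_blockSites_iff {z : ℤ × ℤ} {v : Site 2} :
    v ∈ blockSites s z δ ↔ s * z.1 ≤ δ * v 0 ∧ δ * v 0 ≤ s * (z.1 + 1) ∧ s * z.2 ≤ δ * v 1 ∧ δ * v 1 ≤ s * (z.2 + 1) := by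
  simp [blockSites, block, meshPoint_re, meshPoint_im]

/-- Sites of tube blocks are tube sites. [folklore] -/
theorem blockSites_subset_Nset {z : ℤ × ℤ} (hz : z ∈ tubeBlocks s α) : blockSites s z δ ⊆ Nset s α δ :=
  fun _ hv => ⟨z, hz, hv⟩

/-- The step relation of tube sites. [folklore] -/
def NStep (s : ℝ) (α : Set ℂ) (δ : ℝ) (a b : Site 2) : Prop :=
  a ∈ Nset s α δ ∧ b ∈ Nset s α δ ∧ ∃ k : Fin 4, b = a + cornerUnit k

/-- A line move inside a set of tube sites. [folklore] -/
theorem nStep_line {S : Set (Site 2)} (hS : S ⊆ Nset s α δ) (a : Site 2) (k : Fin 4) (n : ℕ)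
    (hP : ∀ j : ℕ, j ≤ n → a + (j : ℤ) • cornerUnit k ∈ S) :
    ReflTransGen (NStep s α δ) a (a + (n : ℤ) • cornerUnit k) := by
  have h := CellComplex.reflTransGen_line (· ∈ S) a k n hP
  revert h
  generalize a + (n : ℤ) • cornerUnit k = b
  intro h
  induction h with
  | refl => exact ReflTransGen.refl
  | tail _ hst ih =>
    obtain ⟨h1, h2, hadj⟩ := hst
    exact ih.tail ⟨hS h1, hS h2, CellComplex.adj_iff_exists_cornerUnit.1 hadj⟩

/-- **The sites of a tube block are joined inside the block** (a staircase: first abscissa, then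
ordinate). [folklore] -/
theorem nStep_of_mem_blockSites {z : ℤ × ℤ} (hz : z ∈ tubeBlocks s α) (hδ : 0 < δ) {u v : Site 2}
    (hu : u ∈ blockSites s z δ) (hv : v ∈ blockSites s z δ) : ReflTransGen (NStep s α δ) u v := by
  have hS := blockSites_subset_Nset (δ := δ) hz
  rw [mem_blockSites_iff] at hu hv
  obtain ⟨hu1, hu2, hu3, hu4⟩ := hu
  obtain ⟨hv1, hv2, hv3, hv4⟩ := hv
  -- the corner `c = (v 0, u 1)`
  set c : Site 2 := ![v 0, u 1] with hc
  -- horizontal leg `u → c`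
  have leg1 : ReflTransGen (NStep s α δ) u c := by
    rcases le_total (u 0) (v 0) with h | h
    · -- move east by `n = v 0 - u 0`
      have key := nStep_line hS u 0 (v 0 - u 0).toNat (fun j hj => ?_)
      · convert key using 1
        rw [hc]; funext i; fin_cases i <;> simp [cornerUnit, Int.toNat_of_nonneg (sub_nonneg.2 h)]
      · rw [mem_blockSites_iff]
        have hj' : (j : ℤ) ≤ v 0 - u 0 := by
          have := Int.toNat_of_nonneg (sub_nonneg.2 h); omega
        simp only [cornerUnit, Fin.isValue, Pi.add_apply, Pi.smul_apply, smul_eq_mul]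
        simp
        refine ⟨?_, ?_, hu3, hu4⟩
        · have : (0 : ℝ) ≤ δ * j := by positivity
          nlinarith
        · have : δ * ((u 0 : ℝ) + j) ≤ δ * (v 0 : ℝ) := by
            apply mul_le_mul_of_nonneg_left _ hδ.le
            exact_mod_cast (by omega : u 0 + (j : ℤ) ≤ v 0)
          nlinarith
    · -- move west by `n = u 0 - v 0`
      have key := nStep_line hS u 2 (u 0 - v 0).toNat (fun j hj => ?_)
      · convert key using 1
        rw [hc]; funext i; fin_cases i <;> simp [cornerUnit, Int.toNat_of_nonneg (sub_nonneg.2 h)]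
      · rw [mem_blockSites_iff]
        have hj' : (j : ℤ) ≤ u 0 - v 0 := by
          have := Int.toNat_of_nonneg (sub_nonneg.2 h); omega
        simp only [cornerUnit, Fin.isValue, Pi.add_apply, Pi.smul_apply, smul_eq_mul]
        simp
        refine ⟨?_, ?_, hu3, hu4⟩
        · have : δ * (v 0 : ℝ) ≤ δ * ((u 0 : ℝ) - j) := by
            apply mul_le_mul_of_nonneg_left _ hδ.le
            exact_mod_cast (by omega : v 0 ≤ u 0 - (j : ℤ))
          nlinarith
        · have : (0 : ℝ) ≤ δ * j := by positivity
          nlinarith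
  -- vertical leg `c → v`
  have leg2 : ReflTransGen (NStep s α δ) c v := by
    have hc0 : c 0 = v 0 := by simp [hc]
    have hc1 : c 1 = u 1 := by simp [hc]
    rcases le_total (u 1) (v 1) with h | h
    · have key := nStep_line hS c 1 (v 1 - u 1).toNat (fun j hj => ?_)
      · convert key using 1
        funext i; fin_cases i <;> simp [hc, cornerUnit, Int.toNat_of_nonneg (sub_nonneg.2 h)]
      · rw [mem_blockSites_iff]
        have hj' : (j : ℤ) ≤ v 1 - u 1 := by
          have := Int.toNat_of_nonneg (sub_nonneg.2 h); omega
        simp only [cornerUnit, Fin.isValue, Pi.add_apply, Pi.smul_apply, smul_eq_mul, hc0, hc1]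
        simp
        refine ⟨hv1, hv2, ?_, ?_⟩
        · have : (0 : ℝ) ≤ δ * j := by positivity
          nlinarith
        · have : δ * ((u 1 : ℝ) + j) ≤ δ * (v 1 : ℝ) := by
            apply mul_le_mul_of_nonneg_left _ hδ.le
            exact_mod_cast (by omega : u 1 + (j : ℤ) ≤ v 1)
          nlinarith
    · have key := nStep_line hS c 3 (u 1 - v 1).toNat (fun j hj => ?_)
      · convert key using 1
        funext i; fin_cases i <;> simp [hc, cornerUnit, Int.toNat_of_nonneg (sub_nonneg.2 h)]
      · rw [mem_blockSites_iff]
        have hj' : (j : ℤ) ≤ u 1 - v 1 := by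
          have := Int.toNat_of_nonneg (sub_nonneg.2 h); omega
        simp only [cornerUnit, Fin.isValue, Pi.add_apply, Pi.smul_apply, smul_eq_mul, hc0, hc1]
        simp
        refine ⟨hv1, hv2, ?_, ?_⟩
        · have : δ * (v 1 : ℝ) ≤ δ * ((u 1 : ℝ) - j) := by
            apply mul_le_mul_of_nonneg_left _ hδ.le
            exact_mod_cast (by omega : v 1 ≤ u 1 - (j : ℤ))
          nlinarith
        · have : (0 : ℝ) ≤ δ * j := by positivity
          nlinarith
  exact leg1.trans leg2

/-! ### Adjacent blocks carry adjacent sites -/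

/-- **Horizontally adjacent blocks carry horizontally adjacent sites** (for meshes `δ ≤ s`). [folklore] -/
theorem exists_adj_sites_right (hδ : 0 < δ) (hδs : δ ≤ s) (z : ℤ × ℤ) :
    ∃ v ∈ blockSites s z δ, v + cornerUnit 0 ∈ blockSites s (z.1 + 1, z.2) δ := by
  set x : ℝ := s * (z.1 + 1) / δ with hx
  set y : ℝ := s * z.2 / δ with hy
  have hx1 : (⌊x⌋ : ℝ) * δ ≤ s * (z.1 + 1) := by rw [← le_div_iff₀ hδ]; exact Int.floor_le x
  have hx2 : s * (z.1 + 1) < ((⌊x⌋ : ℝ) + 1) * δ := by rw [← div_lt_iff₀ hδ]; exact Int.lt_floor_add_one x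
  have hy1 : s * z.2 ≤ (⌈y⌉ : ℝ) * δ := by rw [← div_le_iff₀ hδ]; exact Int.le_ceil y
  have hy2 : ((⌈y⌉ : ℝ) - 1) * δ < s * z.2 := by rw [← lt_div_iff₀ hδ]; linarith [Int.ceil_lt_add_one y]
  refine ⟨![⌊x⌋, ⌈y⌉], ?_, ?_⟩
  · rw [mem_blockSites_iff]
    simp only [Matrix.cons_val_zero, Matrix.cons_val_one]
    refine ⟨by nlinarith, by nlinarith, by nlinarith, by nlinarith⟩
  · rw [mem_blockSites_iff]
    simp only [cornerUnit, Fin.isValue, Pi.add_apply, Matrix.cons_val_zero, Matrix.cons_val_one]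
    simp
    refine ⟨by nlinarith, by nlinarith, by nlinarith, by nlinarith⟩

/-- **Vertically adjacent blocks carry vertically adjacent sites** (for meshes `δ ≤ s`). [folklore] -/
theorem exists_adj_sites_up (hδ : 0 < δ) (hδs : δ ≤ s) (z : ℤ × ℤ) :
    ∃ v ∈ blockSites s z δ, v + cornerUnit 1 ∈ blockSites s (z.1, z.2 + 1) δ := by
  set x : ℝ := s * z.1 / δ with hx
  set y : ℝ := s * (z.2 + 1) / δ with hy
  have hy1 : (⌊y⌋ : ℝ) * δ ≤ s * (z.2 + 1) := by rw [← le_div_iff₀ hδ]; exact Int.floor_le y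
  have hy2 : s * (z.2 + 1) < ((⌊y⌋ : ℝ) + 1) * δ := by rw [← div_lt_iff₀ hδ]; exact Int.lt_floor_add_one y
  have hx1 : s * z.1 ≤ (⌈x⌉ : ℝ) * δ := by rw [← div_le_iff₀ hδ]; exact Int.le_ceil x
  have hx2 : ((⌈x⌉ : ℝ) - 1) * δ < s * z.1 := by rw [← lt_div_iff₀ hδ]; linarith [Int.ceil_lt_add_one x]
  refine ⟨![⌈x⌉, ⌊y⌋], ?_, ?_⟩
  · rw [mem_blockSites_iff]
    simp only [Matrix.cons_val_zero, Matrix.cons_val_one]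
    refine ⟨by nlinarith, by nlinarith, by nlinarith, by nlinarith⟩
  · rw [mem_blockSites_iff]
    simp only [cornerUnit, Fin.isValue, Pi.add_apply, Matrix.cons_val_zero, Matrix.cons_val_one]
    simp
    refine ⟨by nlinarith, by nlinarith, by nlinarith, by nlinarith⟩

/-- Sites of consecutive tube blocks of the chain are joined by tube steps. [folklore] -/
theorem nStep_of_oneStep (hδ : 0 < δ) (hδs : δ ≤ s) {a b : ℤ × ℤ} (ha : a ∈ tubeBlocks s α)
    (hb : b ∈ tubeBlocks s α) (hab : OneStep a b) {u w : Site 2} (hu : u ∈ blockSites s a δ)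
    (hw : w ∈ blockSites s b δ) : ReflTransGen (NStep s α δ) u w := by
  -- a bridging pair of adjacent sites `p ∈ a`, `p' ∈ b` (or `a = b`)
  have bridge : a = b ∨ ∃ p ∈ blockSites s a δ, ∃ p' ∈ blockSites s b δ, ∃ k : Fin 4, p' = p + cornerUnit k := by
    rcases hab with ⟨h1, h2⟩ | ⟨h2, h1⟩
    · rcases (show b.2 = a.2 ∨ b.2 = a.2 + 1 ∨ b.2 = a.2 - 1 by rw [abs_le] at h2; omega) with e | e | e
      · exact Or.inl (Prod.ext h1 e.symm)
      · right
        obtain ⟨p, hp, hp'⟩ := exists_adj_sites_up (δ := δ) hδ hδs a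
        exact ⟨p, hp, _, by rwa [show b = (a.1, a.2 + 1) from Prod.ext h1.symm e], 1, rfl⟩
      · right
        obtain ⟨q, hq, hq'⟩ := exists_adj_sites_up (δ := δ) hδ hδs b
        refine ⟨q + cornerUnit 1, by rwa [show a = (b.1, b.2 + 1) from Prod.ext h1 (by omega)], q, hq, 3, ?_⟩
        rw [add_assoc]; simp [cornerUnit]
    · rcases (show b.1 = a.1 ∨ b.1 = a.1 + 1 ∨ b.1 = a.1 - 1 by rw [abs_le] at h1; omega) with e | e | e
      · exact Or.inl (Prod.ext e.symm h2)
      · right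
        obtain ⟨p, hp, hp'⟩ := exists_adj_sites_right (δ := δ) hδ hδs a
        exact ⟨p, hp, _, by rwa [show b = (a.1 + 1, a.2) from Prod.ext e h2.symm], 0, rfl⟩
      · right
        obtain ⟨q, hq, hq'⟩ := exists_adj_sites_right (δ := δ) hδ hδs b
        refine ⟨q + cornerUnit 0, by rwa [show a = (b.1 + 1, b.2) from Prod.ext (by omega) h2], q, hq, 2, ?_⟩
        rw [add_assoc]; simp [cornerUnit]
  rcases bridge with rfl | ⟨p, hp, p', hp', k, hk⟩
  · exact nStep_of_mem_blockSites ha hδ hu hw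
  · refine ((nStep_of_mem_blockSites ha hδ hu hp).tail ⟨blockSites_subset_Nset ha hp,
      blockSites_subset_Nset hb hp', k, hk⟩).trans (nStep_of_mem_blockSites hb hδ hp' hw)

/-- **Any two tube sites of a connected cut are joined by tube steps** (for meshes `δ ≤ s`). [folklore] -/
theorem nStep_of_mem_Nset (hs : 0 < s) (hδ : 0 < δ) (hδs : δ ≤ s) (hα : Bornology.IsBounded α)
    (hαc : IsPreconnected α) {u v : Site 2} (hu : u ∈ Nset s α δ) (hv : v ∈ Nset s α δ) :
    ReflTransGen (NStep s α δ) u v := by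
  obtain ⟨zu, hzu, hu⟩ := hu
  obtain ⟨zv, hzv, hv⟩ := hv
  have chain := tubeBlocks_chain hs hα hαc hzu hzv
  -- induction along the chain of blocks, for all sites of the final block
  suffices H : ∀ w ∈ blockSites s zv δ, ReflTransGen (NStep s α δ) u w from H v hv
  clear hv
  induction chain with
  | refl => exact fun w hw => nStep_of_mem_blockSites hzu hδ hu hw
  | @tail a b _ hab ih =>
    intro w hw
    obtain ⟨ha, hb, hstep⟩ := hab
    -- any site of `a` reaches `w`; pick one (blocks are nonempty for `δ ≤ s`)
    obtain ⟨p, hp, -⟩ := exists_adj_sites_right (δ := δ) hδ hδs a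
    exact (ih ha p hp).trans (nStep_of_oneStep hδ hδs ha hb hstep hp hw)

/-- **The `N_conn` property of the zones of a connected cut** (for meshes `δ ≤ s`).
[cite: SchrammSmirnov2011, §4, proof of Prop. 4.1 (the neighbourhood of α is connected)] -/
theorem zones_N_conn (hs : 0 < s) (hδ : 0 < δ) (hδs : δ ≤ s) (hα : Bornology.IsBounded α)
    (hαc : IsPreconnected α) :
    ∀ u ∈ (zones hs hδ hα).N, ∀ v ∈ (zones hs hδ hα).N,
      ReflTransGen (fun a b => a ∈ (zones hs hδ hα).N ∧ b ∈ (zones hs hδ hα).N ∧ ∃ k : Fin 4, b = a + cornerUnit k) u v := by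
  intro u hu v hv
  rw [mem_zones_N] at hu hv
  refine ReflTransGen.mono (fun a b h => ?_) u v (nStep_of_mem_Nset hs hδ hδs hα hαc hu hv)
  exact ⟨(mem_zones_N hs hδ hα).2 h.1, (mem_zones_N hs hδ hα).2 h.2.1, h.2.2⟩

end CutBlocks

end Literature.Probability.Percolation

end
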